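import Mathlib.GroupTheory.OrderOfElement
import Mathlib.Algebra.Group.Subgroup.Lattice
import Mathlib.Data.Finset.Card
import Mathlib.Tactic.Group
import HarnessLib

/-!
# Prime-order power sets: `⟨u, c⟩ = {uʲ, c uʲ}` for commuting `u` (`uᵖ = 1`) and an involution `c`; two conjugates of a
# subgroup of PRIME order sharing a non-trivial element coincide

COR-CM (cell `pub-hodgecm2`), binder seat b04 (gen 33), count-neutral own lane «Galois-CM-type classification».  KERNEL ONLY,
Mathlib only: theorems; no definition, no named fact, no `sorry`.  Group-theoretic feeder of `CorCM/GaloisSkewSectionPrime` (gen 33: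
a NON-NORMAL subgroup of prime order in a large Galois group yields a CM set with trivial left and non-trivial right stabiliser — the
prime-order sequel of gen 32's `CorCM/GaloisSkewSection`, which is the case `p = 2`).  Conjugates of `⟨u⟩` are handled as the FINSETS
`{a uⁱ a⁻¹ : i < p}` (no decidability of subgroup membership needed downstream).

* `mem_closure_pair_iff_of_pow_eq_one` — `c² = 1`, `uᵖ = 1` (`0 < p`), `cu = uc` ⟹ `Subgroup.closure {u, c} = {uʲ, c uʲ : j < p}`.
* `ne_pow_of_odd_prime` — for an ODD prime `p`: an involution `c ≠ 1` is none of the `uʲ` (`uᵖ = 1`).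
* `image_pow_eq_image_conj_pow` — `u` of prime order `p`, `v = a uʲ a⁻¹`, `0 < j < p` ⟹ `{vⁱ : i < p} = {a uⁱ a⁻¹ : i < p}`.
* `image_conj_pow_eq_of_mem` — hence a conjugate power set containing `v ≠ 1` IS `{vⁱ : i < p}`: two conjugates of `⟨u⟩` meeting
  outside `1` are equal (the one place where primality of the order enters the skew-section count).

## References

* [Shimura1998] G. Shimura, *Abelian Varieties with Complex Multiplication and Modular Functions*, §8.2 Prop. 26 (context only:
  right stabilisers of CM types).
-/

namespace Summit.HodgeConjecture.CorCM.GaloisModels.SkewSectionPrime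

open Finset

variable {G : Type*} [Group G]

/-! ## §1 The group `{u^j, c u^j}` -/

/-- For commuting `u, c` with `u ^ p = 1` (`0 < p`) and `c * c = 1`:
`Subgroup.closure {u, c} = {u ^ j, c * u ^ j : j < p}`. [folklore] -/
theorem mem_closure_pair_iff_of_pow_eq_one {c u : G} {p : ℕ} (hp : 0 < p) (hcc : c * c = 1) (hup : u ^ p = 1)
    (hcu : c * u = u * c) (x : G) :
    x ∈ Subgroup.closure ({u, c} : Set G) ↔ ∃ j < p, (x = u ^ j ∨ x = c * u ^ j) := by
  have hmod : ∀ k, u ^ (k % p) = u ^ k := fun k => by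
    conv_rhs => rw [← Nat.mod_add_div k p, pow_add, pow_mul, hup, one_pow, mul_one]
  have hcomm : ∀ j : ℕ, c * u ^ j = u ^ j * c := fun j => ((show Commute c u from hcu).pow_right j).eq
  have hc' : c⁻¹ = c := inv_eq_of_mul_eq_one_right hcc
  have hinv : ∀ j, (u ^ j)⁻¹ = u ^ ((p - j % p) % p) := fun j => by
    rw [hmod, ← hmod j]
    exact inv_eq_of_mul_eq_one_right (by rw [← pow_add, Nat.add_sub_cancel' (Nat.mod_lt j hp).le, hup])
  constructor
  · intro hx
    induction hx using Subgroup.closure_induction with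
    | mem x hx =>
      simp only [Set.mem_insert_iff, Set.mem_singleton_iff] at hx
      rcases hx with rfl | rfl
      · exact ⟨1 % p, Nat.mod_lt _ hp, Or.inl (by rw [hmod, pow_one])⟩
      · exact ⟨0, hp, Or.inr (by rw [pow_zero, mul_one])⟩
    | one => exact ⟨0, hp, Or.inl (by rw [pow_zero])⟩
    | mul x y _ _ ihx ihy =>
      obtain ⟨i, hi, hx⟩ := ihx
      obtain ⟨j, hj, hy⟩ := ihy
      refine ⟨(i + j) % p, Nat.mod_lt _ hp, ?_⟩
      rcases hx with rfl | rfl <;> rcases hy with rfl | rfl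
      · exact Or.inl (by rw [hmod, pow_add])
      · exact Or.inr (by rw [hmod, pow_add, ← mul_assoc, ← hcomm i, mul_assoc])
      · exact Or.inr (by rw [hmod, pow_add, mul_assoc])
      · exact Or.inl (by rw [hmod, pow_add, mul_assoc, ← mul_assoc (u ^ i), ← hcomm i, mul_assoc, ← mul_assoc c,
          hcc, one_mul])
    | inv x _ ih =>
      obtain ⟨j, hj, hx⟩ := ih
      refine ⟨(p - j % p) % p, Nat.mod_lt _ hp, ?_⟩
      rcases hx with rfl | rfl
      · exact Or.inl (hinv j)
      · exact Or.inr (by rw [mul_inv_rev, hinv, hc', hcomm])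
  · rintro ⟨j, -, rfl | rfl⟩
    · exact Subgroup.pow_mem _ (Subgroup.subset_closure (by simp)) _
    · exact mul_mem (Subgroup.subset_closure (by simp)) (Subgroup.pow_mem _ (Subgroup.subset_closure (by simp)) _)

/-! ## §2 Power sets of elements of prime order -/

variable [DecidableEq G]

/-- For `u` of prime order `p` and `v = a u^j a⁻¹` with `0 < j < p`: the first `p` powers of `v` are exactly the conjugates
`a u^i a⁻¹`, `i < p`. [folklore] -/
theorem image_pow_eq_image_conj_pow {u a v : G} {p : ℕ} [hp : Fact p.Prime] (hu : orderOf u = p) {j : ℕ}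
    (hj0 : 0 < j) (hjp : j < p) (hv : v = a * u ^ j * a⁻¹) :
    (Finset.range p).image (fun i => v ^ i) = (Finset.range p).image (fun i => a * u ^ i * a⁻¹) := by
  have hpos : 0 < p := hp.out.pos
  have hup : u ^ p = 1 := by rw [← hu]; exact pow_orderOf_eq_one u
  have hmod : ∀ k, u ^ (k % p) = u ^ k := fun k => by rw [← hu]; exact pow_mod_orderOf u k
  have hsub : (Finset.range p).image (fun i => v ^ i) ⊆ (Finset.range p).image (fun i => a * u ^ i * a⁻¹) := by
    intro x hx
    obtain ⟨i, -, rfl⟩ := Finset.mem_image.1 hx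
    refine Finset.mem_image.2 ⟨(j * i) % p, Finset.mem_range.2 (Nat.mod_lt _ hpos), ?_⟩
    rw [hv, conj_pow, ← pow_mul, hmod]
  have hv1 : v ≠ 1 := by
    intro h
    rw [hv] at h
    have h' : u ^ j = u ^ 0 := by
      rw [pow_zero]
      have := congrArg (fun x => a⁻¹ * x * a) h
      simpa [mul_assoc] using this
    have := pow_injOn_Iio_orderOf (by rw [hu]; exact hjp) (by rw [hu]; exact hpos) h'
    omega
  have hvp : v ^ p = 1 := by rw [hv, conj_pow, ← pow_mul, mul_comm, pow_mul, hup, one_pow, mul_one, mul_inv_cancel]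
  have hordv : orderOf v = p := orderOf_eq_prime hvp hv1
  refine Finset.eq_of_subset_of_card_le hsub ?_
  rw [Finset.card_image_of_injOn (fun i hi i' hi' h => pow_injOn_Iio_orderOf
    (by rw [hordv]; exact Finset.mem_range.1 hi) (by rw [hordv]; exact Finset.mem_range.1 hi') h), Finset.card_range]
  exact Finset.card_image_le.trans (by rw [Finset.card_range])

/-- Membership in a conjugate power set: `v ∈ {a u^i a⁻¹ : i < p}` with `v ≠ 1` forces the set to be `{v^i : i < p}` (`u` of prime
order `p`) — so two conjugates of `⟨u⟩` sharing a non-trivial element coincide. [folklore] -/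
theorem image_conj_pow_eq_of_mem {u a v : G} {p : ℕ} [hp : Fact p.Prime] (hu : orderOf u = p) (hv1 : v ≠ 1)
    (hv : v ∈ (Finset.range p).image (fun i => a * u ^ i * a⁻¹)) :
    (Finset.range p).image (fun i => a * u ^ i * a⁻¹) = (Finset.range p).image (fun i => v ^ i) := by
  obtain ⟨j, hj, rfl⟩ := Finset.mem_image.1 hv
  have hj0 : 0 < j := by
    rcases Nat.eq_zero_or_pos j with rfl | h
    · exact absurd (by rw [pow_zero, mul_one, mul_inv_cancel]) hv1
    · exact h
  exact (image_pow_eq_image_conj_pow hu hj0 (Finset.mem_range.1 hj) rfl).symm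

omit [DecidableEq G] in
/-- For an ODD prime `p`, an involution `c ≠ 1` is not a power `uʲ` of an element with `uᵖ = 1` (else `c = cᵖ = 1`). [folklore] -/
theorem ne_pow_of_odd_prime {c u : G} {p : ℕ} [hp : Fact p.Prime] (hp2 : p ≠ 2) (hcc : c * c = 1) (hc1 : c ≠ 1)
    (hup : u ^ p = 1) : ∀ j < p, c ≠ u ^ j := by
  intro j _ h
  obtain ⟨k, hk⟩ := hp.out.odd_of_ne_two hp2
  apply hc1
  have h1 : c ^ p = 1 := by rw [h, ← pow_mul, mul_comm, pow_mul, hup, one_pow]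
  have hc2 : c ^ 2 = 1 := by rw [sq, hcc]
  rw [hk, pow_succ, pow_mul, hc2, one_pow, one_mul] at h1
  exact h1

end Summit.HodgeConjecture.CorCM.GaloisModels.SkewSectionPrime
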